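import Literature.RingTheory.MvPowerSeries.MonoidPowerSeriesFaces
import HarnessLib

/-!
# Restriction of `R⟦P⟧` to a face, and the face cut out by a prime ideal

`Literature/RingTheory/MvPowerSeries/MonoidPowerSeriesFaceRestrict.lean` (first half of the
dimension theory; the bound itself is `MonoidPowerSeriesDimension.lean`). K. Kato, *Toric
singularities*, Amer. J. Math. 116 (1994), §3 uses `dim R[[P]][[T₁, …, T_r]] = dim R + dim P + r`
for a complete regular local `R` and a fine sharp monoid `P` (proof of (3.2): "since
`dim (k[[P]][[T]]) = dim(Pᵍᵖ) + r = dim 𝒪_{X,x}`"); Gabber–Ramero, §6.5, Prop. 6.5.3: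
`dim S_P⁻¹A[P] = dim A + dim P`. We PROVE the inequality that the structure theorem needs, for the
rendering `R⟦P⟧ = monoidPowerSeries R P` (`P ⊆ ℕ^{(σ)}` finitely generated, `σ` finite, `R`
Noetherian local):

  `ringKrullDim R⟦P⟧ ≤ ringKrullDim R + rank P`   (`monoidPowerSeries.ringKrullDim_le`).

Proof (induction on `rank P` through the FACES of `P`, avoiding the identification of `R⟦P⟧`
with an adic completion): for `P ≠ 0` let `x₀ = x^{p₀}`, `p₀` the sum of the generators. By
Krull, `dim R⟦P⟧ ≤ dim (R⟦P⟧/x₀) + 1`. A prime `𝔓 ∋ x₀` determines the face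
`F(𝔓) = {q ∈ P | x^q ∉ 𝔓}` (`primeFace`), which is proper (`p₀ ∉ F(𝔓)`), and `𝔓` contains the
kernel of the restriction `R⟦P⟧ → R⟦F(𝔓)⟧` (`faceRestrict`; the kernel is generated by the
monomials of the generators outside `F(𝔓)`, all in `𝔓`). Hence a chain of primes above `x₀` is
a chain of primes of `R⟦F⟧ ≅ R⟦P⟧/ker` for the proper face `F = F(𝔓₀)` of its bottom, of length
`≤ dim R + rank F ≤ dim R + rank P − 1` by induction (`rank_lt_of_isFace`).

References: [Kato1994] K. Kato, Toric singularities, Amer. J. Math. 116 (1994), §3 (proof of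
(3.2)), §5; Gabber–Ramero, Foundations for almost ring theory, arXiv:math/0409584, Prop. 6.5.3.
-/

noncomputable section

open MvPowerSeries Pointwise

namespace Literature.RingTheory.MvPowerSeries

namespace monoidPowerSeries

universe u v

variable {σ : Type u} {R : Type v} [CommRing R]

/-! ### Restriction to a face -/

section FaceRestrict

variable {F P : AddSubmonoid (σ →₀ ℕ)}

open Classical in
/-- Restriction of coefficients to a face, on coefficient functions. [cite: Kato1994, §3] -/
def faceRestrictFun (F : AddSubmonoid (σ →₀ ℕ)) (f : MvPowerSeries σ R) : MvPowerSeries σ R :=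
  fun e => if e ∈ F then MvPowerSeries.coeff e f else 0

open Classical in
/-- Coefficients of the restriction. [cite: Kato1994, §3] -/
theorem coeff_faceRestrictFun (f : MvPowerSeries σ R) (e : σ →₀ ℕ) :
    MvPowerSeries.coeff e (faceRestrictFun (R := R) F f) =
      if e ∈ F then MvPowerSeries.coeff e f else 0 :=
  rfl

/-- The restriction is supported on `F`. [cite: Kato1994, §3] -/
theorem faceRestrictFun_mem (f : MvPowerSeries σ R) :
    faceRestrictFun (R := R) F f ∈ monoidPowerSeries R F := by
  intro e he
  rw [coeff_faceRestrictFun, if_neg he]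

/-- Restriction to a FACE is multiplicative on `R⟦P⟧`: if `a + b = e` with `a, b ∈ P` then
`e ∈ F ↔ a ∈ F ∧ b ∈ F`. [cite: Kato1994, §3] -/
theorem faceRestrictFun_mul (hF : IsFace F P) {f g : MvPowerSeries σ R}
    (hf : f ∈ monoidPowerSeries R P) (hg : g ∈ monoidPowerSeries R P) :
    faceRestrictFun (R := R) F (f * g) = faceRestrictFun F f * faceRestrictFun F g := by
  classical
  ext e
  rw [coeff_faceRestrictFun, MvPowerSeries.coeff_mul, MvPowerSeries.coeff_mul]
  by_cases he : e ∈ F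
  · rw [if_pos he]
    refine Finset.sum_congr rfl fun x hx => ?_
    rw [Finset.HasAntidiagonal.mem_antidiagonal] at hx
    rw [coeff_faceRestrictFun, coeff_faceRestrictFun]
    by_cases h1 : x.1 ∈ P
    · by_cases h2 : x.2 ∈ P
      · rw [if_pos (hF.mem_of_add_mem _ h1 _ h2 (hx.symm ▸ he)),
          if_pos (hF.mem_of_add_mem' h1 h2 (hx.symm ▸ he))]
      · rw [hg _ h2, mul_zero]
        split_ifs <;> simp
    · rw [hf _ h1, zero_mul]
      split_ifs <;> simp
  · rw [if_neg he]
    symm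
    refine Finset.sum_eq_zero fun x hx => ?_
    rw [Finset.HasAntidiagonal.mem_antidiagonal] at hx
    rw [coeff_faceRestrictFun, coeff_faceRestrictFun]
    by_cases h1 : x.1 ∈ F
    · have h2 : x.2 ∉ F := fun h2 => he (hx ▸ F.add_mem h1 h2)
      rw [if_neg h2, mul_zero]
    · rw [if_neg h1, zero_mul]

/-- **Restriction to a face** `R⟦P⟧ → R⟦F⟧`, `∑_{e ∈ P} a_e x^e ↦ ∑_{e ∈ F} a_e x^e`, an
`R`-algebra homomorphism (the quotient of `R⟦P⟧` by the ideal of the prime ideal `P ∖ F`; Kato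
(7.2): `𝒪_{X,x}/𝔭𝒪_{X,x}` with the log structure `M_x ∖ 𝔭`). [cite: Kato1994, §3 and (7.2)] -/
def faceRestrict (hF : IsFace F P) : monoidPowerSeries R P →ₐ[R] monoidPowerSeries R F where
  toFun f := ⟨faceRestrictFun F (f : MvPowerSeries σ R), faceRestrictFun_mem _⟩
  map_one' := by
    classical
    refine Subtype.ext ?_
    ext e
    rw [Subtype.coe_mk, Subalgebra.coe_one, coeff_faceRestrictFun, Subalgebra.coe_one,
      MvPowerSeries.coeff_one]
    by_cases he : e ∈ F
    · rw [if_pos he]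
    · rw [if_neg he, if_neg]
      rintro rfl
      exact he F.zero_mem
  map_mul' f g := Subtype.ext (by
    rw [Subalgebra.coe_mul, Subtype.coe_mk, Subalgebra.coe_mul]
    exact faceRestrictFun_mul hF f.2 g.2)
  map_zero' := by
    refine Subtype.ext ?_
    ext e
    rw [Subtype.coe_mk, Subalgebra.coe_zero, coeff_faceRestrictFun, map_zero, Subalgebra.coe_zero,
      map_zero, ite_self]
  map_add' f g := by
    refine Subtype.ext ?_
    ext e
    simp only [Subalgebra.coe_add, coeff_faceRestrictFun, map_add]
    split_ifs <;> simp
  commutes' r := by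
    classical
    refine Subtype.ext ?_
    ext e
    rw [Subtype.coe_mk, Subalgebra.coe_algebraMap, Subalgebra.coe_algebraMap,
      MvPowerSeries.algebraMap_apply, Algebra.algebraMap_self, RingHom.id_apply,
      coeff_faceRestrictFun, MvPowerSeries.coeff_C]
    by_cases he : e ∈ F
    · rw [if_pos he]
    · rw [if_neg he, if_neg]
      rintro rfl
      exact he F.zero_mem

/-- Coefficients of the restriction to a face. [cite: Kato1994, §3] -/
theorem coeff_faceRestrict (hF : IsFace F P) (f : monoidPowerSeries R P) (e : σ →₀ ℕ) :
    haveI := Classical.dec (e ∈ F)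
    MvPowerSeries.coeff e ((faceRestrict (R := R) hF f : monoidPowerSeries R F) : MvPowerSeries σ R)
      = if e ∈ F then MvPowerSeries.coeff e (f : MvPowerSeries σ R) else 0 := by
  classical
  exact coeff_faceRestrictFun _ e

/-- The restriction to a face is surjective (it is the identity on `R⟦F⟧ ⊆ R⟦P⟧`).
[cite: Kato1994, §3] -/
theorem faceRestrict_surjective (hF : IsFace F P) :
    Function.Surjective (faceRestrict (R := R) hF) := by
  classical
  intro f
  refine ⟨⟨(f : MvPowerSeries σ R), mono hF.le f.2⟩, Subtype.ext ?_⟩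
  ext e
  rw [coeff_faceRestrict, Subtype.coe_mk]
  by_cases he : e ∈ F
  · rw [if_pos he]
  · rw [if_neg he, f.2 e he]

/-- The kernel of the restriction to a face: the series supported on `P ∖ F`.
[cite: Kato1994, §3] -/
theorem mem_ker_faceRestrict_iff (hF : IsFace F P) (f : monoidPowerSeries R P) :
    f ∈ RingHom.ker (faceRestrict (R := R) hF).toRingHom ↔
      ∀ e ∈ F, MvPowerSeries.coeff e (f : MvPowerSeries σ R) = 0 := by
  classical
  rw [RingHom.mem_ker]
  constructor
  · intro h e he
    have := congrArg (fun g : monoidPowerSeries R F => MvPowerSeries.coeff e (g : MvPowerSeries σ R)) h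
    simp only [AlgHom.toRingHom_eq_coe, RingHom.coe_coe, coeff_faceRestrict, if_pos he,
      Subalgebra.coe_zero, map_zero] at this
    exact this
  · intro h
    refine Subtype.ext ?_
    ext e
    rw [AlgHom.toRingHom_eq_coe, RingHom.coe_coe, coeff_faceRestrict, Subalgebra.coe_zero, map_zero]
    by_cases he : e ∈ F
    · rw [if_pos he, h e he]
    · rw [if_neg he]

end FaceRestrict

/-! ### The face of a prime ideal -/

section PrimeFace

variable {P : AddSubmonoid (σ →₀ ℕ)}

/-- The **face of `P` cut out by a prime ideal `𝔓` of `R⟦P⟧`**: the exponents `q ∈ P` whose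
monomial `x^q` is NOT in `𝔓` (the inverse image in `P` of the complement of `𝔓`; Kato (7.5):
"let `p ∈ Spec(P)` be the inverse image of the prime ideal of `𝒪_{X,y}`"). [cite: Kato1994, (7.5)] -/
def primeFace (𝔓 : Ideal (monoidPowerSeries R P)) [𝔓.IsPrime] : AddSubmonoid (σ →₀ ℕ) where
  carrier := {q | ∃ h : q ∈ P, (⟨MvPowerSeries.monomial q (1 : R), monomial_mem h 1⟩ :
    monoidPowerSeries R P) ∉ 𝔓}
  zero_mem' := ⟨P.zero_mem, by
    have : (⟨MvPowerSeries.monomial (0 : σ →₀ ℕ) (1 : R), monomial_mem P.zero_mem 1⟩ :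
        monoidPowerSeries R P) = 1 := Subtype.ext (MvPowerSeries.monomial_zero_one)
    rw [this]
    exact fun h => Ideal.IsPrime.ne_top' (Ideal.eq_top_of_isUnit_mem _ h isUnit_one)⟩
  add_mem' := by
    rintro a b ⟨ha, ha'⟩ ⟨hb, hb'⟩
    refine ⟨P.add_mem ha hb, fun hab => ?_⟩
    have hmul : (⟨MvPowerSeries.monomial (a + b) (1 : R), monomial_mem (P.add_mem ha hb) 1⟩ :
        monoidPowerSeries R P) =
        ⟨MvPowerSeries.monomial a (1 : R), monomial_mem ha 1⟩ *
          ⟨MvPowerSeries.monomial b (1 : R), monomial_mem hb 1⟩ := by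
      refine Subtype.ext ?_
      change MvPowerSeries.monomial (a + b) (1 : R) =
        MvPowerSeries.monomial a (1 : R) * MvPowerSeries.monomial b (1 : R)
      rw [MvPowerSeries.monomial_mul_monomial, one_mul]
    rw [hmul] at hab
    rcases Ideal.IsPrime.mem_or_mem ‹_› hab with h | h
    · exact ha' h
    · exact hb' h

/-- Membership in the prime face. [cite: Kato1994, (7.5)] -/
theorem mem_primeFace_iff (𝔓 : Ideal (monoidPowerSeries R P)) [𝔓.IsPrime] {q : σ →₀ ℕ}
    (hq : q ∈ P) :
    q ∈ primeFace 𝔓 ↔ (⟨MvPowerSeries.monomial q (1 : R), monomial_mem hq 1⟩ :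
      monoidPowerSeries R P) ∉ 𝔓 :=
  ⟨fun ⟨_, h⟩ => h, fun h => ⟨hq, h⟩⟩

/-- The prime face is a face of `P`: if `x^{a+b} = x^a x^b ∉ 𝔓` then `x^a ∉ 𝔓`.
[cite: Kato1994, (7.5)] -/
theorem isFace_primeFace (𝔓 : Ideal (monoidPowerSeries R P)) [𝔓.IsPrime] :
    IsFace (primeFace 𝔓) P := by
  refine ⟨fun q ⟨hq, _⟩ => hq, fun a ha b hb ⟨_, hab⟩ => ⟨ha, fun haP => hab ?_⟩⟩
  have hmul : (⟨MvPowerSeries.monomial (a + b) (1 : R), monomial_mem (P.add_mem ha hb) 1⟩ :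
      monoidPowerSeries R P) =
      ⟨MvPowerSeries.monomial b (1 : R), monomial_mem hb 1⟩ *
        ⟨MvPowerSeries.monomial a (1 : R), monomial_mem ha 1⟩ := by
    refine Subtype.ext ?_
    change MvPowerSeries.monomial (a + b) (1 : R) =
      MvPowerSeries.monomial b (1 : R) * MvPowerSeries.monomial a (1 : R)
    rw [MvPowerSeries.monomial_mul_monomial, one_mul, add_comm]
  rw [hmul]
  exact Ideal.mul_mem_left _ _ haP

/-- **A prime `𝔓` of `R⟦P⟧` contains the kernel of the restriction to its face `F(𝔓)`**: a
series supported on `P ∖ F(𝔓)` is a finite combination `∑ x^{gᵢ} hᵢ` over the generators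
`gᵢ ∉ F(𝔓)` of `P`, and these `x^{gᵢ}` lie in `𝔓`. [cite: Kato1994, (7.5)] -/
theorem ker_faceRestrict_primeFace_le (hP : P.FG) (𝔓 : Ideal (monoidPowerSeries R P))
    [𝔓.IsPrime] :
    RingHom.ker (faceRestrict (R := R) (isFace_primeFace 𝔓)).toRingHom ≤ 𝔓 := by
  classical
  obtain ⟨S, hS⟩ := hP
  intro f hf
  rw [mem_ker_faceRestrict_iff] at hf
  have hSP : ∀ g ∈ S, g ∈ P := fun g hg => by
    rw [← hS]; exact AddSubmonoid.subset_closure hg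
  -- every `q ∈ P ∖ F` is `g + q'` with `g ∈ S ∖ F`, `q' ∈ P`
  have hdec : ∀ q ∈ P, q ∉ primeFace 𝔓 →
      ∃ g ∈ S, g ∉ primeFace 𝔓 ∧ ∃ q' ∈ P, q = g + q' := by
    intro q hq hqF
    have hrange : Set.range (fun x : S => (x : σ →₀ ℕ)) = (S : Set (σ →₀ ℕ)) := by ext; simp
    have hq' : q ∈ AddSubmonoid.closure (Set.range (fun x : S => (x : σ →₀ ℕ))) := by
      rw [hrange, hS]; exact hq
    obtain ⟨d, hd⟩ := exists_expSum_eq_of_mem_closure (fun x : S => (x : σ →₀ ℕ)) hq'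
    have hex : ∃ i ∈ d.support, ((i : S) : σ →₀ ℕ) ∉ primeFace 𝔓 := by
      by_contra hcon
      apply hqF
      rw [← hd]
      change ∑ i ∈ d.support, d i • ((i : S) : σ →₀ ℕ) ∈ primeFace 𝔓
      refine AddSubmonoid.sum_mem _ fun i hi => AddSubmonoid.nsmul_mem _ ?_ _
      exact Classical.not_not.1 fun hiF => hcon ⟨i, hi, hiF⟩
    obtain ⟨i, hi, hiF⟩ := hex
    refine ⟨i, i.2, hiF, expSum (fun x : S => (x : σ →₀ ℕ)) (d - Finsupp.single i 1), ?_, ?_⟩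
    · have hmem := expSum_mem_closure (fun x : S => (x : σ →₀ ℕ)) (d - Finsupp.single i 1)
      rw [hrange, hS] at hmem
      exact hmem
    · rw [← hd]
      have hsplit : d = Finsupp.single i 1 + (d - Finsupp.single i 1) := by
        rw [add_tsub_cancel_of_le]
        exact Finsupp.single_le_iff.2 (Nat.one_le_iff_ne_zero.2 (Finsupp.mem_support_iff.1 hi))
      conv_lhs => rw [hsplit]
      rw [expSum_add, expSum_single, one_smul]
  choose! gen hgenS hgenF rest hrestP hq_eq using hdec
  -- decomposition `f = ∑_{g ∈ S, g ∉ F} x^g * h_g`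
  let T : Finset (σ →₀ ℕ) := S.filter (fun g => g ∉ primeFace 𝔓)
  let h : (σ →₀ ℕ) → MvPowerSeries σ R := fun g e =>
    if e + g ∈ P ∧ e + g ∉ primeFace 𝔓 ∧ gen (e + g) = g then
      MvPowerSeries.coeff (e + g) (f : MvPowerSeries σ R) else 0
  have hcoeffh : ∀ g e, MvPowerSeries.coeff e (h g) =
      if e + g ∈ P ∧ e + g ∉ primeFace 𝔓 ∧ gen (e + g) = g then
        MvPowerSeries.coeff (e + g) (f : MvPowerSeries σ R) else 0 := fun _ _ => rfl
  have hmemh : ∀ g, h g ∈ monoidPowerSeries R P := by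
    intro g e he
    rw [hcoeffh, if_neg]
    rintro ⟨h1, h2, h3⟩
    apply he
    have heq := hq_eq (e + g) h1 h2
    rw [h3] at heq
    have he' : e = rest (e + g) := add_left_cancel ((add_comm g e).trans heq)
    rw [he']
    exact hrestP _ h1 h2
  have hsum : (f : MvPowerSeries σ R) =
      ∑ g ∈ T, MvPowerSeries.monomial g (1 : R) * h g := by
    ext e
    rw [map_sum]
    simp only [MvPowerSeries.coeff_monomial_mul, one_mul]
    by_cases heP : e ∈ P
    · by_cases heF : e ∈ primeFace 𝔓
      · rw [hf e heF]
        symm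
        refine Finset.sum_eq_zero fun g _ => ?_
        split_ifs with hge
        · rw [hcoeffh, if_neg]
          rintro ⟨-, h2, -⟩
          exact h2 (by rwa [tsub_add_cancel_of_le hge])
        · rfl
      · have hgT : gen e ∈ T := by
          simp only [T, Finset.mem_filter]
          exact ⟨hgenS e heP heF, hgenF e heP heF⟩
        rw [Finset.sum_eq_single (gen e)]
        · have hle : gen e ≤ e := by
            have h' := hq_eq e heP heF
            calc gen e ≤ gen e + rest e := le_self_add
              _ = e := h'.symm
          rw [if_pos hle, hcoeffh, tsub_add_cancel_of_le hle, if_pos ⟨heP, heF, rfl⟩]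
        · intro g _ hgne
          split_ifs with hge
          · rw [hcoeffh, tsub_add_cancel_of_le hge, if_neg]
            rintro ⟨-, -, h3⟩
            exact hgne h3.symm
          · rfl
        · intro hnot
          exact (hnot hgT).elim
    · rw [f.2 e heP]
      symm
      refine Finset.sum_eq_zero fun g _ => ?_
      split_ifs with hge
      · rw [hcoeffh, tsub_add_cancel_of_le hge, if_neg]
        rintro ⟨h1, -, -⟩
        exact heP h1
      · rfl
  -- conclude
  have hf' : f = ∑ g ∈ T.attach, (⟨MvPowerSeries.monomial (g : σ →₀ ℕ) (1 : R),
      monomial_mem (hSP g (Finset.mem_filter.1 g.2).1) 1⟩ : monoidPowerSeries R P) *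
        ⟨h g, hmemh g⟩ := by
    refine Subtype.ext ?_
    rw [hsum, AddSubmonoidClass.coe_finsetSum, ← Finset.sum_attach T]
    rfl
  rw [hf']
  refine Ideal.sum_mem _ fun g _ => Ideal.mul_mem_right _ _ ?_
  by_contra hnot
  exact (Finset.mem_filter.1 g.2).2 ((mem_primeFace_iff 𝔓 (hSP g (Finset.mem_filter.1 g.2).1)).2 hnot)

end PrimeFace

end monoidPowerSeries

end Literature.RingTheory.MvPowerSeries
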